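import Literature.AlgebraicGeometry.Morphisms.ProjectiveMorphism
import Literature.AlgebraicGeometry.Motives.ProjectiveDescentNormProofs
import Mathlib.AlgebraicGeometry.Morphisms.Affine
import HarnessLib

/-!
# Finite sets of points of a scheme affine over some `Proj`, or projective over an affine base, lie in affine opens
# ([MumfordAV1970] §7 Remark p. 69; [Liu2002] Prop. 3.3.36; [GortzWedhorn2020] Prop. 13.49)

Topic `AlgebraicGeometry/Morphisms`; namespace `Literature.AlgebraicGeometry.Morphisms`.
THEOREMS ONLY (no definition, no named fact, no instance, no notation, no `sorry`; net Literature debt 0).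

Mumford's hypothesis for the quotient of a scheme by a finite group ([MumfordAV1970] §7 Thm. p. 66) — «every finite set of
points lies in an affine open» (Remark p. 69: automatic for quasi-projective varieties) — in the tree's currency
`∀ s : Finset X, ∃ U : X.Opens, IsAffineOpen U ∧ ∀ x ∈ s, x ∈ U` (★ `AbelianSchemeConstSubgroupStableCover.
translationActionOver_hcov_of_forall_finset`, ★ `AbelianSchemeBaseQuotientDescentOfAffineBase.exists_abelianScheme_desc_of_forall_finset`).
The tree proves it for quasi-projective schemes over a FIELD (★ `QuasiProjectiveFinsetAffineOpen`, ★
`Motives.IsProjectiveOver.finiteSubsetsInAffineOpens`); THIS FILE proves it WITHOUT a ground field: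

* §1 `exists_isAffineOpen_forall_mem_of_isAffineHom_toProj` — for ANY graded ring `𝒜` and any scheme `X` admitting an AFFINE
  morphism `q : X → Proj 𝒜` (e.g. a closed subscheme of `ℙⁿ_R = Proj R[x₀,…,xₙ]`, or of `ℙⁿ_ℤ ×_ℤ Spec R`): graded prime
  avoidance (★ `Motives.GradedPrimeAvoidance.exists_form_basicOpen`) gives a form `F` of positive degree with `q(s) ⊆ D₊(F)`,
  and `q⁻¹ D₊(F)` is affine (`D₊(F)` affine, `q` affine).
* §2 **`exists_isAffineOpen_forall_mem_of_isProjective`** — for `f : X → Y` PROJECTIVE in the tree's sense (★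
  `Morphisms.IsProjective`: a closed immersion `j : X ↪ 𝐏(ι; Y) = Y ×_ℤ ℙⁿ_ℤ` over `Y`) with `Y` AFFINE: every finite set of
  points of `X` lies in an affine open — §1 for `q := j ≫ pr₂ : X → ℙⁿ_ℤ = Proj ℤ[x₀,…,xₙ]`, affine because `pr₂` is a base
  change of the affine `Y → Spec ℤ`.

Cell `hodgecm-mathlib` (D-0151), FLOOR 0 programme P1, sub-line `Cruxes/HDel/Lines/F3DualAbelianScheme`, stub (M) `stub_F3M`,
inner cut v0.1 step (M-d)(d2): §2 discharges the `hfin` input of ★-to-be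
`AbelianSchemeBaseQuotientDescentOfAffineBase.exists_abelianScheme_desc_of_forall_finset` for the étale-local dual
`Â′ → S′ → Spec R` as soon as `Â′ → Spec R` (or `Â′ → S′`, `S′` affine) is known projective; §1 serves any other
projectivity currency that exhibits an affine map to a `Proj`.  Count-neutral; HC_CM is proved only modulo the 7 printed
citations until rung 0 closes; nothing here is about HC.

Mathlib searched (pin): `Proj.isAffineOpen_basicOpen`, `IsAffineOpen.preimage`, `isAffineHom_of_isAffine`,
`MorphismProperty.pullback_snd` / the `IsAffineHom (pullback.snd _ _)` instance (used); Mathlib has `Proj` and graded prime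
avoidance ingredients but no «finite subsets in affine opens» lemma for projective schemes.

## References
* D. Mumford, *Abelian Varieties* (1970), §7 Thm. p. 66 (hypothesis) and Remark p. 69. [MumfordAV1970]
* Q. Liu, *Algebraic Geometry and Arithmetic Curves* (2002), Prop. 3.3.36 (p. 109). [Liu2002]
* U. Görtz, T. Wedhorn, *Algebraic Geometry I*, 2nd ed. (2020), Prop. 13.49 (p. 393). [GortzWedhorn2020]
-/

noncomputable section

universe u

open CategoryTheory CategoryTheory.Limits AlgebraicGeometry TopologicalSpace
open Literature.AlgebraicGeometry.Motives

namespace Literature.AlgebraicGeometry.Morphisms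

/-! ### §1 Schemes affine over some `Proj 𝒜` -/

/-- **Finitely many points of a scheme AFFINE over some `Proj 𝒜` lie in an affine open**: graded prime avoidance gives a
form `F` of positive degree with the (finitely many) images in `D₊(F)` (★ `GradedPrimeAvoidance.exists_form_basicOpen` on
`Proj 𝒜` itself), and `q⁻¹ D₊(F)` is affine because `D₊(F)` is (Mathlib `Proj.isAffineOpen_basicOpen`) and `q` is an affine
morphism. [cite: MumfordAV1970, §7 Remark p. 69] [cite: GortzWedhorn2020, Prop. 13.49 (p. 393)] -/
theorem exists_isAffineOpen_forall_mem_of_isAffineHom_toProj {A : Type u} {σ : Type*} [CommRing A] [SetLike σ A]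
    [AddSubgroupClass σ A] (𝒜 : ℕ → σ) [GradedRing 𝒜] {X : Scheme.{u}} (q : X ⟶ Proj 𝒜) [IsAffineHom q]
    (s : Finset X) : ∃ U : X.Opens, IsAffineOpen U ∧ ∀ x ∈ s, x ∈ U := by
  classical
  obtain ⟨n, F, hn, hF, hT, -⟩ := GradedPrimeAvoidance.exists_form_basicOpen 𝒜 (𝟙 (Proj 𝒜)) Function.injective_id
    IsClosedMap.id (s.image q) ⊤ (fun _ _ => trivial)
  refine ⟨q ⁻¹ᵁ Proj.basicOpen 𝒜 F, (Proj.isAffineOpen_basicOpen 𝒜 F hF hn).preimage q, fun x hx => ?_⟩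
  have h := hT (q x) (Finset.mem_image_of_mem _ hx)
  simpa using h

/-! ### §2 Projective over an affine base -/

/-- **Finitely many points of a scheme PROJECTIVE over an AFFINE base lie in an affine open** ([MumfordAV1970] §7 Remark
p. 69, [Liu2002] Prop. 3.3.36, without a ground field): for `f : X → Y` projective (★ `IsProjective`: `X ↪ 𝐏(ι; Y) → Y`, `j` a
closed immersion) and `Y` affine, the composite `X ↪ 𝐏(ι; Y) = Y ×_ℤ ℙⁿ_ℤ → ℙⁿ_ℤ = Proj ℤ[x₀, …, xₙ]` is AFFINE (a closed
immersion followed by a base change of the affine `Y → Spec ℤ`), so §1 applies.  This is the `hfin` input of ★-to-be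
`exists_abelianScheme_desc_of_forall_finset` / ★ `translationActionOver_hcov_of_forall_finset` for projective abelian schemes over
affine bases. [cite: MumfordAV1970, §7 Remark p. 69] [cite: Liu2002, Prop. 3.3.36 (p. 109)] -/
theorem exists_isAffineOpen_forall_mem_of_isProjective {X Y : Scheme.{u}} [IsAffine Y] {f : X ⟶ Y}
    (hf : IsProjective f) (s : Finset X) : ∃ U : X.Opens, IsAffineOpen U ∧ ∀ x ∈ s, x ∈ U := by
  obtain ⟨ι, _, j, hj, -⟩ := hf
  haveI : IsClosedImmersion j := hj
  -- the grading of `ℤ[x₀, …, xₙ]` behind the tree's `projectiveSpaceInt ι = Proj (grading ι)` (a local `letI`, no attribute)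
  letI : GradedRing (grading ι) := MvPolynomial.gradedAlgebra
  haveI h₁ : IsAffineHom j := inferInstance
  haveI h₂ : IsAffineHom (pullback.snd (terminal.from Y) (terminal.from (projectiveSpaceInt ι))) :=
    MorphismProperty.pullback_snd _ _ inferInstance
  haveI : IsAffineHom (j ≫ pullback.snd (terminal.from Y) (terminal.from (projectiveSpaceInt ι))) :=
    MorphismProperty.comp_mem _ _ _ h₁ h₂
  exact exists_isAffineOpen_forall_mem_of_isAffineHom_toProj (grading ι)
    (j ≫ pullback.snd (terminal.from Y) (terminal.from (projectiveSpaceInt ι))) s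

end Literature.AlgebraicGeometry.Morphisms

end
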